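import Summits.Ventures.HSemireg.WedgeHankelRecurrenceGaussRatioPartialFractions

/-!
# Venture HSemireg — **EXISTENCE OF THE ORTHOGONAL SYSTEM (Gram–Schmidt on the powers)**: for a positive discrete measure `(ν, w)` with `N` distinct nodes and every `n < N` there are monic
# `q_0 = 1, q_1, …, q_n`, `deg q_k = k`, pairwise `(ν, w)`-orthogonal — hence each `q_k` is orthogonal to every polynomial of degree `< k` and `Σ ν q_k² > 0`; the step is
# `q_{n+1} = X q_n − Σ_{j ≤ n} (⟨X q_n, q_j⟩/⟨q_j, q_j⟩) q_j` — so the hypotheses «an orthogonal system is given» of N273 ∕ N275 ∕ N277 are always satisfiable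

HONEST FRAMING. Part of the Lean index of the computation cell `pub-hsemireg` (seat p10 gen 42, Sunday typer «UNIFORM-IN-n»).  Real polynomials and finite sums only; no variety, no
cohomology theory, no sheaf, no Ext group and no semiregularity map is constructed here; nothing here says that HC / HC_CM / HC_AV holds; no Literature fact (unproved `Prop`) is declared or
used.  Custodian versions as in `WedgeHankelSiegelIdeal` (1/3).
SOURCES (cited).  G. Szegő, *Orthogonal Polynomials*, AMS Colloq. Publ. 23, §2.2 (2.2.1)–(2.2.6) (construction of the orthonormal system from the moments; Gram–Schmidt); T. S. Chihara,
*An Introduction to Orthogonal Polynomials* (1978), Ch. I Thm 3.1 (existence and uniqueness of the monic OPS for a positive-definite functional); E. Schmidt, Math. Ann. 63 (1907) §§1–2.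
PROOF TYPED HERE.  Induction on `n`; the new polynomial is `X q_n − Σ_{j ≤ n} c_j q_j` with `c_j = Σν (X q_n) q_j ∕ Σν q_j²` (`Σν q_j² > 0` by N273 `sum_mul_eval_sq_pos_of_natDegree_lt`, since
`deg q_j = j < N`); its pairing with `q_i`, `i ≤ n`, is `Σν (Xq_n) q_i − c_i Σν q_i² = 0`.  The family is stored as a function `ℕ → ℝ[X]` updated at `n + 1` (`Function.update`).
DEDUP DISCLOSURE (`rg -n 'gramSchmidt|Gram-Schmidt|Gram–Schmidt' Summits/Ventures/HSemireg`, 2026-09-02): Mathlib's `gramSchmidt` is for inner-product spaces (not used: the lineage keeps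
explicit finite sums); nothing in this lineage.  The 3 names below: 0 hits tree-wide.

WHAT IS IN THE TREE.  N273 `sum_mul_eval_sq_pos_of_natDegree_lt`; N285 `orthogonal_lower_of_pairwise`; Mathlib `Function.update`, `Polynomial.natDegree_sub_eq_left_of_natDegree_lt`.
THIS FILE (namespace `Summit.Ventures.HSemireg.Wedge.HankelOuter` continued; CHAINED on N288 (import), N273, N285; 0 definitions):
* §1054 `gramSchmidt_step` (from a pairwise-orthogonal monic family of degrees `0..n` to one of degrees `0..n+1`), **`exists_orthogonal_system`** (∃ `q : ℕ → ℝ[X]` with `q 0 = 1`, `q_k` monic of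
  degree `k` and pairwise orthogonal for `k ≤ n < N`), `exists_orthogonal_system_lower` (the same family is orthogonal to all lower degrees and has `Σν q_k² > 0`).
CAVEATS.  Nothing Ext-side.  New names only.
-/

open Module Polynomial
open scoped Matrix Polynomial

namespace Summit.Ventures.HSemireg.Wedge.HankelOuter

/-! ## §1054. Gram–Schmidt -/

/-- **The Gram–Schmidt step**: given monic `q_0, …, q_n` (`deg q_k = k`, `q_0 = 1`) pairwise `(ν, w)`-orthogonal with `ν > 0`, `w` injective, `n + 1 < N`, the family updated at `n + 1` by
`X q_n − Σ_{j ≤ n} (Σν (Xq_n) q_j ∕ Σν q_j²) q_j` is monic of the right degrees and pairwise orthogonal up to `n + 1`. [Szegő §2.2; Chihara I Thm 3.1; this file, §1054] -/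
theorem gramSchmidt_step {N n : ℕ} {ν w : Fin N → ℝ} (hν : ∀ l, 0 < ν l) (hw : Function.Injective w) (hnN : n + 1 < N) {q : ℕ → ℝ[X]} (hq0 : q 0 = 1)
    (hmonic : ∀ k, k ≤ n → (q k).Monic) (hdeg : ∀ k, k ≤ n → (q k).natDegree = k)
    (hpair : ∀ i j, i ≤ n → j ≤ n → i ≠ j → ∑ l, ν l * ((q i).eval (w l) * (q j).eval (w l)) = 0) :
    ∃ q' : ℕ → ℝ[X], q' 0 = 1 ∧ (∀ k, k ≤ n → q' k = q k) ∧ (∀ k, k ≤ n + 1 → (q' k).Monic) ∧ (∀ k, k ≤ n + 1 → (q' k).natDegree = k) ∧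
      ∀ i j, i ≤ n + 1 → j ≤ n + 1 → i ≠ j → ∑ l, ν l * ((q' i).eval (w l) * (q' j).eval (w l)) = 0 := by
  -- the norms are positive
  have hh : ∀ j, j ≤ n → 0 < ∑ l, ν l * ((q j).eval (w l)) ^ 2 := fun j hj =>
    sum_mul_eval_sq_pos_of_natDegree_lt hν hw (hmonic j hj).ne_zero (by rw [hdeg j hj]; omega)
  set c : ℕ → ℝ := fun j => (∑ l, ν l * ((Polynomial.X * q n).eval (w l) * (q j).eval (w l))) / ∑ l, ν l * ((q j).eval (w l)) ^ 2 with hc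
  set P : ℝ[X] := Polynomial.X * q n - ∑ j ∈ Finset.range (n + 1), C (c j) * q j with hP
  have hXm : (Polynomial.X * q n).Monic := monic_X.mul (hmonic n le_rfl)
  have hXd : (Polynomial.X * q n).natDegree = n + 1 := by rw [monic_X.natDegree_mul (hmonic n le_rfl), natDegree_X, hdeg n le_rfl]; ring
  have hSd : (∑ j ∈ Finset.range (n + 1), C (c j) * q j).natDegree ≤ n := by
    refine natDegree_sum_le_of_forall_le _ _ fun j hj => (natDegree_C_mul_le _ _).trans ?_
    have := Finset.mem_range.1 hj
    rw [hdeg j (by omega)]; omega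
  have hlt : (∑ j ∈ Finset.range (n + 1), C (c j) * q j).degree < (Polynomial.X * q n).degree := by
    rw [degree_eq_natDegree hXm.ne_zero, hXd]
    exact lt_of_le_of_lt degree_le_natDegree (by exact_mod_cast Nat.lt_succ_of_le hSd)
  have hPm : P.Monic := hXm.sub_of_left hlt
  have hPd : P.natDegree = n + 1 := by
    have hd := degree_sub_eq_left_of_degree_lt hlt
    rw [degree_eq_natDegree hXm.ne_zero, hXd] at hd
    exact natDegree_eq_of_degree_eq_some hd
  -- `P ⊥ q_i` for `i ≤ n`
  have hPorth : ∀ i, i ≤ n → ∑ l, ν l * (P.eval (w l) * (q i).eval (w l)) = 0 := fun i hi => by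
    have e : ∀ l, ν l * (P.eval (w l) * (q i).eval (w l))
        = ν l * ((Polynomial.X * q n).eval (w l) * (q i).eval (w l)) - ∑ j ∈ Finset.range (n + 1), c j * (ν l * ((q j).eval (w l) * (q i).eval (w l))) := fun l => by
      rw [hP, eval_sub, eval_finsetSum]
      simp only [eval_mul, eval_C]
      rw [sub_mul, mul_sub, Finset.sum_mul, Finset.mul_sum]
      exact congrArg _ (Finset.sum_congr rfl fun j _ => by ring)
    rw [Finset.sum_congr rfl fun l _ => e l, Finset.sum_sub_distrib, Finset.sum_comm, ← Finset.sum_congr rfl fun j _ => (Finset.mul_sum _ _ _)]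
    -- only `j = i` survives
    rw [Finset.sum_eq_single i (fun j hj hji => by rw [hpair j i (by have := Finset.mem_range.1 hj; omega) hi hji, mul_zero])
      (fun h => absurd (Finset.mem_range.2 (by omega)) h)]
    rw [hc]
    simp only
    rw [div_mul_eq_mul_div, show ∑ l, ν l * ((q i).eval (w l) * (q i).eval (w l)) = ∑ l, ν l * ((q i).eval (w l)) ^ 2 from Finset.sum_congr rfl fun l _ => by ring,
      mul_div_assoc, div_self (hh i hi).ne', mul_one, sub_self]
  refine ⟨Function.update q (n + 1) P, ?_, fun k hk => ?_, fun k hk => ?_, fun k hk => ?_, fun i j hi hj hij => ?_⟩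
  · rw [Function.update_of_ne (by omega), hq0]
  · exact Function.update_of_ne (by omega) _ _
  · rcases Nat.lt_or_ge k (n + 1) with h | h
    · rw [Function.update_of_ne (by omega)]; exact hmonic k (by omega)
    · rw [show k = n + 1 by omega, Function.update_self]; exact hPm
  · rcases Nat.lt_or_ge k (n + 1) with h | h
    · rw [Function.update_of_ne (by omega)]; exact hdeg k (by omega)
    · rw [show k = n + 1 by omega, Function.update_self]; exact hPd
  · rcases Nat.lt_or_ge i (n + 1) with hi' | hi'
    · rcases Nat.lt_or_ge j (n + 1) with hj' | hj'
      · rw [Function.update_of_ne (by omega), Function.update_of_ne (by omega)]; exact hpair i j (by omega) (by omega) hij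
      · rw [show j = n + 1 by omega, Function.update_self, Function.update_of_ne (by omega)]
        rw [show ∑ l, ν l * ((q i).eval (w l) * P.eval (w l)) = ∑ l, ν l * (P.eval (w l) * (q i).eval (w l)) from Finset.sum_congr rfl fun l _ => by ring]
        exact hPorth i (by omega)
    · have hi2 : i = n + 1 := by omega
      have hj2 : j < n + 1 := by omega
      rw [hi2, Function.update_self, Function.update_of_ne (by omega)]
      exact hPorth j (by omega)

/-- **EXISTENCE OF THE MONIC ORTHOGONAL SYSTEM**: for `ν > 0`, `w` injective on `Fin N` and `n < N`, there is `q : ℕ → ℝ[X]` with `q 0 = 1`, `q_k` monic of degree `k` for `k ≤ n`, and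
`Σ_l ν_l q_i(w_l) q_j(w_l) = 0` for `i ≠ j ≤ n`. [Szegő §2.2; Chihara I Thm 3.1; this file, §1054] -/
theorem exists_orthogonal_system {N : ℕ} {ν w : Fin N → ℝ} (hν : ∀ l, 0 < ν l) (hw : Function.Injective w) {n : ℕ} (hn : n < N) :
    ∃ q : ℕ → ℝ[X], q 0 = 1 ∧ (∀ k, k ≤ n → (q k).Monic) ∧ (∀ k, k ≤ n → (q k).natDegree = k) ∧
      ∀ i j, i ≤ n → j ≤ n → i ≠ j → ∑ l, ν l * ((q i).eval (w l) * (q j).eval (w l)) = 0 := by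
  induction n with
  | zero =>
    refine ⟨fun _ => 1, rfl, fun k hk => monic_one, fun k hk => by rw [natDegree_one]; omega, fun i j hi hj hij => ?_⟩
    omega
  | succ n ih =>
    obtain ⟨q, hq0, hm, hd, hp⟩ := ih (by omega)
    obtain ⟨q', hq0', -, hm', hd', hp'⟩ := gramSchmidt_step hν hw hn hq0 hm hd hp
    exact ⟨q', hq0', hm', hd', hp'⟩

/-- **… and the system is orthogonal to all lower degrees, with positive norms** (ready for N273 ∕ N275 ∕ N277). [Szegő §2.2; this file, §1054] -/
theorem exists_orthogonal_system_lower {N : ℕ} {ν w : Fin N → ℝ} (hν : ∀ l, 0 < ν l) (hw : Function.Injective w) {n : ℕ} (hn : n < N) :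
    ∃ q : ℕ → ℝ[X], q 0 = 1 ∧ (∀ k, k ≤ n → (q k).Monic) ∧ (∀ k, k ≤ n → (q k).natDegree = k) ∧
      (∀ k, k ≤ n → ∀ G : ℝ[X], G.natDegree < k → ∑ l, ν l * (q k * G).eval (w l) = 0) ∧ ∀ k, k ≤ n → 0 < ∑ l, ν l * ((q k).eval (w l)) ^ 2 := by
  obtain ⟨q, hq0, hm, hd, hp⟩ := exists_orthogonal_system hν hw hn
  refine ⟨q, hq0, hm, hd, fun k hk G hG => orthogonal_lower_of_pairwise hm hd hp hk hG, fun k hk => ?_⟩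
  exact sum_mul_eval_sq_pos_of_natDegree_lt hν hw (hm k hk).ne_zero (by rw [hd k hk]; omega)

end Summit.Ventures.HSemireg.Wedge.HankelOuter
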